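import Literature.AlgebraicGeometry.Motives.ProjectiveSpaceRingPoints
import Literature.AlgebraicGeometry.Motives.SmoothHypersurfaceScheme
import HarnessLib

/-!
# The coordinate charts `X_F ∩ D₊(xᵢ)` of a projective hypersurface

For a field `k`, a homogeneous form `F ∈ k[x₀, …, x_{n+1}]` of positive degree `d` and the reduced
hypersurface `X_F = V₊(F) ⊂ ℙⁿ⁺¹_k` of `Motives/SmoothHypersurfaceScheme` (Hartshorne II Example
3.2.6), this file describes the affine open pieces `X_F ∩ D₊(xᵢ)` (Hartshorne II Prop. 2.5 and
Prop. 5.9: a closed subscheme is `Spec (A/𝔞)` over each affine open `Spec A`):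

* `SmoothHypersurface.ChartRing F i hF` — the coordinate ring `A_i = k[x]_{(xᵢ)} / √(F/xᵢᵈ)` of
  `X_F ∩ D₊(xᵢ)` (the reduced induced structure on `V₊(F) ∩ D₊(xᵢ) = V(F/xᵢᵈ)`), a `k`-algebra
  quotient of the chart algebra `k[x]_{(xᵢ)}` (`toChartRing`, `ker_toChartRing`), identified with
  Mathlib's sections description `Γ(D₊(xᵢ))/𝓘(D₊(xᵢ))` by `chartRingEquiv`
  (`idealSheaf_ideal_coordChartOpen`: the one geometric computation);
* `SmoothHypersurface.chart F i hF hd : specOver k (ChartRing F i hF) ⟶ hypersurface F` — the open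
  immersion onto `X_F ∩ D₊(xᵢ)` (`opensRange_chart_left`), with
  `chart ≫ hypersurfaceι = Spec (toChartRing) ≫ (D₊(xᵢ) ↪ ℙⁿ⁺¹)` (`chart_hypersurfaceι`);
* the **tautological vector** `tautVec = (xⱼ/xᵢ)ⱼ ∈ A_iⁿ⁺²` (`tautVec_self`, `aeval_tautVec_eq_zero :
  F(tautVec) = 0`, `toChartRing (g/xᵢᵐ) = g(tautVec)`);
* the **universal property into reduced algebras** (`liftVec`): a vector `v ∈ Sⁿ⁺²` over a reduced
  `k`-algebra `S` with `vᵢ` a unit and `F(v) = 0` gives `A_i →ₐ[k] S`, `xⱼ/xᵢ ↦ vⱼ vᵢ⁻¹`, and the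
  resulting `S`-point of `X_F` is, in `ℙⁿ⁺¹`, the point with homogeneous coordinates `v`
  (`specOverOfAlgHom_liftVec_chart_hypersurfaceι`, via `ProjectiveSpace.vecChartPoint`).

## References

* R. Hartshorne, *Algebraic Geometry*, GTM 52 (1977): II Prop. 2.5, II Example 3.2.6, II Prop. 5.9.
  [Hartshorne1977]
-/

noncomputable section

open CategoryTheory AlgebraicGeometry HomogeneousLocalization MvPolynomial

universe u

namespace Literature.AlgebraicGeometry.Motives.SmoothHypersurface

open ProjSubscheme ProjectiveSpace

variable {k : Type u} [Field k] {n : ℕ} {d : ℕ}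

attribute [local instance] MvPolynomial.gradedAlgebra ProjBaseChange.algebraBase

local notation "𝒜" => MvPolynomial.homogeneousSubmodule (Fin (n + 2)) k

/-! ### The chart ring `A_i = k[x]_{(xᵢ)} / √(F/xᵢᵈ)` -/

variable (k) in
/-- The affine open `D₊(xᵢ) ⊆ ℙⁿ⁺¹_k`. [folklore] -/
abbrev coordChartOpen (i : Fin (n + 2)) : (Proj 𝒜).affineOpens :=
  affineBasicOpen 𝒜 (X i) (X_mem i) one_pos

/-- The equation of `X_F` on the chart `D₊(xᵢ)`: `fᵢ = F/xᵢᵈ ∈ k[x]_{(xᵢ)}` (Mathlib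
`Away.isLocalizationElem`). [folklore] -/
abbrev chartEqn (F : MvPolynomial (Fin (n + 2)) k) (i : Fin (n + 2)) (hF : F.IsHomogeneous d) :
    Away 𝒜 (X i) :=
  Away.isLocalizationElem (X_mem i) ((mem_homogeneousSubmodule d F).mpr hF)

/-- The ideal `√(F/xᵢᵈ)` of `X_F ∩ D₊(xᵢ)` in the chart algebra `k[x]_{(xᵢ)}`. [folklore] -/
def chartIdeal (F : MvPolynomial (Fin (n + 2)) k) (i : Fin (n + 2)) (hF : F.IsHomogeneous d) :
    Ideal (Away 𝒜 (X i)) :=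
  (Ideal.span {chartEqn F i hF}).radical

/-- **The coordinate ring of `X_F ∩ D₊(xᵢ)`**: `A_i = k[x]_{(xᵢ)} / √(F/xᵢᵈ)` (reduced induced
structure, Hartshorne II Example 3.2.6, Prop. 5.9). [folklore] -/
def ChartRing (F : MvPolynomial (Fin (n + 2)) k) (i : Fin (n + 2)) (hF : F.IsHomogeneous d) : Type u :=
  Away 𝒜 (X i) ⧸ chartIdeal F i hF

variable (F : MvPolynomial (Fin (n + 2)) k) (i : Fin (n + 2)) (hF : F.IsHomogeneous d)

/-- `A_i` is a commutative ring. [folklore] -/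
instance ChartRing.instCommRing : CommRing (ChartRing F i hF) := Ideal.Quotient.commRing _

/-- `A_i` is a `k`-algebra. [folklore] -/
instance ChartRing.instAlgebra : Algebra k (ChartRing F i hF) := Ideal.Quotient.algebra k

/-- **`k[x]_{(xᵢ)} → A_i`**, the quotient map. [folklore] -/
def toChartRing : Away 𝒜 (X i) →ₐ[k] ChartRing F i hF :=
  Ideal.Quotient.mkₐ k (chartIdeal F i hF)

/-- `toChartRing` is the quotient map (`rfl`). [folklore] -/
theorem toChartRing_apply (q : Away 𝒜 (X i)) :
    toChartRing F i hF q = Ideal.Quotient.mk (chartIdeal F i hF) q :=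
  rfl

/-- `toChartRing` is surjective. [folklore] -/
theorem toChartRing_surjective : Function.Surjective (toChartRing F i hF) :=
  Ideal.Quotient.mkₐ_surjective k _

/-- **The ideal of `X_F ∩ D₊(xᵢ)`**: `ker (k[x]_{(xᵢ)} → A_i) = √(F/xᵢᵈ)`. [folklore] -/
theorem ker_toChartRing : RingHom.ker (toChartRing F i hF) = chartIdeal F i hF :=
  Ideal.Quotient.mkₐ_ker k _

/-- `F/xᵢᵈ ↦ 0` in `A_i`. [folklore] -/
theorem toChartRing_chartEqn : toChartRing F i hF (chartEqn F i hF) = 0 := by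
  rw [← RingHom.mem_ker, ker_toChartRing]
  exact Ideal.le_radical (Ideal.subset_span rfl)

/-! ### Comparison with `Γ(D₊(xᵢ))/𝓘(D₊(xᵢ))` -/

/-- The chart isomorphism `k[x]_{(xᵢ)} ≃ Γ(D₊(xᵢ))` as a ring equivalence (Mathlib
`Proj.basicOpenIsoAway`). [folklore] -/
def awayEquivSections : Away 𝒜 (X i) ≃+* Γ(Proj 𝒜, (coordChartOpen k i : (Proj 𝒜).Opens)) :=
  (Proj.basicOpenIsoAway 𝒜 (X i) (X_mem i) one_pos).commRingCatIsoToRingEquiv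

/-- `awayEquivSections` is `awayToSection` (`rfl`). [folklore] -/
theorem awayEquivSections_apply (q : Away 𝒜 (X i)) :
    awayEquivSections (k := k) i q = (Proj.awayToSection 𝒜 (X i)).hom q :=
  rfl

/-- **The reduced induced ideal over `D₊(xᵢ)`** (the one geometric computation): through
`k[x]_{(xᵢ)} ≅ Γ(D₊(xᵢ))`, the ideal of sections `𝓘(D₊(xᵢ))` of the vanishing ideal sheaf of `V₊(F)`
is `√(F/xᵢᵈ)` (`vanishingIdeal_ideal_affineBasicOpen`, `awayι_preimage_zeroLocus`, and the
Nullstellensatz `I(V(f)) = √(f)` for prime spectra). [cite: Hartshorne1977, II Example 3.2.6] -/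
theorem idealSheaf_ideal_coordChartOpen (hd : 0 < d) :
    (idealSheaf F).ideal (coordChartOpen k i) =
      Ideal.map (Proj.awayToSection 𝒜 (X i)).hom (chartIdeal F i hF) := by
  have hpre := awayι_preimage_zeroLocus 𝒜 (X_mem i) one_pos ((mem_homogeneousSubmodule d F).mpr hF) hd
  rw [idealSheaf, vanishingIdeal_ideal_affineBasicOpen, coe_zeroLocusClosed]
  congr 1
  rw [chartIdeal, ← PrimeSpectrum.vanishingIdeal_zeroLocus_eq_radical, PrimeSpectrum.zeroLocus_span]
  exact congrArg PrimeSpectrum.vanishingIdeal hpre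

/-- The same, through the ring equivalence `awayEquivSections`. [folklore] -/
theorem idealSheaf_ideal_coordChartOpen' (hd : 0 < d) :
    (idealSheaf F).ideal (coordChartOpen k i) =
      Ideal.map (awayEquivSections (k := k) i : Away 𝒜 (X i) →+* _) (chartIdeal F i hF) := by
  rw [idealSheaf_ideal_coordChartOpen F i hF hd]
  rfl

/-- **`A_i ≅ Γ(D₊(xᵢ))/𝓘(D₊(xᵢ))`** (Mathlib `Ideal.quotientEquiv` along `k[x]_{(xᵢ)} ≅ Γ(D₊(xᵢ))`).
[folklore] -/
def chartRingEquiv (hd : 0 < d) :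
    ChartRing F i hF ≃+* Γ(Proj 𝒜, (coordChartOpen k i : (Proj 𝒜).Opens)) ⧸
      (idealSheaf F).ideal (coordChartOpen k i) :=
  Ideal.quotientEquiv _ _ (awayEquivSections i) (idealSheaf_ideal_coordChartOpen' F i hF hd)

/-- `chartRingEquiv ∘ toChartRing = (mk 𝓘) ∘ (k[x]_{(xᵢ)} ≅ Γ(D₊(xᵢ)))` (`rfl` pointwise). [folklore] -/
theorem chartRingEquiv_toChartRing (hd : 0 < d) (q : Away 𝒜 (X i)) :
    chartRingEquiv F i hF hd (toChartRing F i hF q) =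
      Ideal.Quotient.mk _ ((Proj.awayToSection 𝒜 (X i)).hom q) :=
  rfl

/-- `toChartRing = chartRingEquiv⁻¹ ∘ (mk 𝓘) ∘ (k[x]_{(xᵢ)} ≅ Γ(D₊(xᵢ)))`. [folklore] -/
theorem toChartRing_eq_symm_comp (hd : 0 < d) :
    (toChartRing F i hF).toRingHom =
      (chartRingEquiv F i hF hd).symm.toRingHom.comp
        ((Ideal.Quotient.mk ((idealSheaf F).ideal (coordChartOpen k i))).comp
          (Proj.awayToSection 𝒜 (X i)).hom) := by
  refine RingHom.ext fun q => (chartRingEquiv F i hF hd).injective ?_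
  change chartRingEquiv F i hF hd (toChartRing F i hF q) =
    chartRingEquiv F i hF hd ((chartRingEquiv F i hF hd).symm
      (Ideal.Quotient.mk _ ((Proj.awayToSection 𝒜 (X i)).hom q)))
  rw [RingEquiv.apply_symm_apply]
  rfl

/-! ### The tautological vector `(xⱼ/xᵢ)ⱼ` -/

/-- **Algebra maps out of `k[x]_{(xᵢ)}` are evaluations** (ring version of
`ProjectiveSpace.algHom_awayMk_eq_aeval`): `e (g/xᵢᵐ) = g(e(x₀/xᵢ), …)` for any `k`-algebra map `e`
into a commutative `k`-algebra. [cite: Hartshorne1977, I Thm. 3.4 (proof)] -/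
theorem algHom_awayMk_eq_aeval_ring {S : Type u} [CommRing S] [Algebra k S]
    (e : Away 𝒜 (X i) →ₐ[k] S) {m : ℕ} (g : MvPolynomial (Fin (n + 2)) k) (hg : g ∈ 𝒜 (m • 1)) :
    e (Away.mk 𝒜 (X_mem i) m g hg) = aeval (fun j => e (coord i j)) g := by
  rw [← toChart_ofChart i (Away.mk 𝒜 (X_mem i) m g hg)]
  change e (toChart k i (ofChartRingHom k i _)) = _
  rw [ofChartRingHom_mk, toChart, dehomogenize, ← AlgHom.comp_apply, ← AlgHom.comp_apply,
    comp_aeval, comp_aeval]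
  refine DFunLike.congr_fun (congrArg aeval (funext fun s => ?_)) g
  rcases Fin.eq_self_or_eq_succAbove i s with rfl | ⟨j, rfl⟩
  · simp
  · simp

/-- **The tautological vector** `(xⱼ/xᵢ)ⱼ ∈ A_iⁿ⁺²` of the chart `X_F ∩ D₊(xᵢ)`. [folklore] -/
def tautVec : Fin (n + 2) → ChartRing F i hF := fun j => toChartRing F i hF (coord i j)

/-- Unfolding `tautVec` (`rfl`). [folklore] -/
theorem tautVec_apply (j : Fin (n + 2)) : tautVec F i hF j = toChartRing F i hF (coord i j) := rfl

/-- `(tautVec) i = xᵢ/xᵢ = 1`. [folklore] -/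
@[simp]
theorem tautVec_self : tautVec F i hF i = 1 := by
  rw [tautVec_apply, coord_self, map_one]

/-- `toChartRing (g/xᵢᵐ) = g(tautVec)`. [folklore] -/
theorem toChartRing_mk {m : ℕ} (g : MvPolynomial (Fin (n + 2)) k) (hg : g ∈ 𝒜 (m • 1)) :
    toChartRing F i hF (Away.mk 𝒜 (X_mem i) m g hg) = aeval (tautVec F i hF) g :=
  algHom_awayMk_eq_aeval_ring i (toChartRing F i hF) g hg

/-- `xᵢ(tautVec) = 1` is a unit. [folklore] -/
theorem isUnit_aeval_tautVec_X :
    IsUnit (aeval (tautVec F i hF) (X i : MvPolynomial (Fin (n + 2)) k)) := by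
  rw [aeval_X, tautVec_self]
  exact isUnit_one

/-- **The tautological vector lies on `X_F`**: `F(tautVec) = 0` in `A_i`. [folklore] -/
theorem aeval_tautVec_eq_zero : aeval (tautVec F i hF) F = 0 := by
  have h := toChartRing_chartEqn F i hF
  rw [chartEqn, Away.isLocalizationElem] at h
  rwa [toChartRing_mk, pow_one] at h

/-- `k`-algebra maps out of `A_i` are determined by their values on the tautological vector.
[folklore] -/
theorem algHom_ext_tautVec {S : Type u} [CommRing S] [Algebra k S]
    {φ ψ : ChartRing F i hF →ₐ[k] S} (h : ∀ j, φ (tautVec F i hF j) = ψ (tautVec F i hF j)) :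
    φ = ψ := by
  refine AlgHom.ext fun a => ?_
  obtain ⟨q, rfl⟩ := toChartRing_surjective F i hF a
  obtain ⟨m, g, hg, rfl⟩ := Away.mk_surjective 𝒜 (X_mem i) q
  rw [toChartRing_mk, ← AlgHom.comp_apply, ← AlgHom.comp_apply, comp_aeval, comp_aeval]
  exact DFunLike.congr_fun (congrArg aeval (funext h)) g

/-! ### The open immersion `Spec A_i → X_F` -/

/-- The structure ring map of Mathlib's sections chart, `k → k[x]_{(xᵢ)} ≅ Γ(D₊(xᵢ)) → Γ/𝓘`.
[folklore] -/
theorem subschemePiece_comp_hom :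
    subschemePiece (idealSheaf F) (coordChartOpen k i) ≫ (hypersurface F).hom =
      Spec.map (CommRingCat.ofHom (((Ideal.Quotient.mk _).comp
        (Proj.awayToSection 𝒜 (X i)).hom).comp (algebraMap k (Away 𝒜 (X i))))) := by
  change subschemePiece (idealSheaf F) (coordChartOpen k i) ≫
      ((idealSheaf F).subschemeι ≫ ProjBaseChange.projToSpec (Fin (n + 2)) k) = _
  rw [reassoc_of% subschemePiece_ι_toSpecZero 𝒜 (X i) (X_mem i) one_pos (idealSheaf F),
    ← Spec.map_comp]
  rfl

/-- **The chart `Spec A_i → X_F`** of `X_F ∩ D₊(xᵢ)`, as a morphism of `k`-schemes: `Spec` of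
`A_i ≅ Γ(D₊(xᵢ))/𝓘` followed by Mathlib's affine piece of the closed subscheme
(`ProjSubscheme.subschemePiece`; Hartshorne II Prop. 5.9). [folklore] -/
def chart (hd : 0 < d) : specOver k (ChartRing F i hF) ⟶ hypersurface F :=
  Over.homMk (Spec.map (chartRingEquiv F i hF hd).toCommRingCatIso.inv ≫
      subschemePiece (idealSheaf F) (coordChartOpen k i)) (by
    have h := subschemePiece_comp_hom F i
    change Spec.map (CommRingCat.ofHom (chartRingEquiv F i hF hd).symm.toRingHom) ≫
      subschemePiece (idealSheaf F) (coordChartOpen k i) ≫ (hypersurface F).hom =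
        Spec.map (CommRingCat.ofHom (algebraMap k (ChartRing F i hF)))
    rw [h, ← Spec.map_comp, ← CommRingCat.ofHom_comp, ← RingHom.comp_assoc,
      ← toChartRing_eq_symm_comp F i hF hd, AlgHom.toRingHom_eq_coe, AlgHom.comp_algebraMap])

/-- The underlying morphism of `chart` (`rfl`). [folklore] -/
theorem chart_left (hd : 0 < d) : (chart F i hF hd).left =
    Spec.map (chartRingEquiv F i hF hd).toCommRingCatIso.inv ≫
      subschemePiece (idealSheaf F) (coordChartOpen k i) :=
  rfl

/-- `Spec A_i → X_F` is an open immersion (an isomorphism followed by Mathlib's open piece).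
[folklore] -/
instance isOpenImmersion_chart_left (hd : 0 < d) : IsOpenImmersion (chart F i hF hd).left :=
  inferInstanceAs (IsOpenImmersion (Spec.map (chartRingEquiv F i hF hd).toCommRingCatIso.inv ≫
      subschemePiece (idealSheaf F) (coordChartOpen k i)))

/-- The image of `Spec A_i → X_F` is `X_F ∩ D₊(xᵢ)`. [folklore] -/
theorem opensRange_chart_left (hd : 0 < d) :
    (chart F i hF hd).left.opensRange = (hypersurfaceι F).left ⁻¹ᵁ Proj.basicOpen 𝒜 (X i) :=
  (Scheme.Hom.opensRange_comp_of_isIso (Spec.map (chartRingEquiv F i hF hd).toCommRingCatIso.inv)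
    (subschemePiece (idealSheaf F) (coordChartOpen k i))).trans
      (opensRange_subschemePiece (idealSheaf F) (coordChartOpen k i))

/-- The image of `Spec A_i → X_F` is `X_F ∩ D₊(xᵢ)` (as a set). [folklore] -/
theorem range_chart_left (hd : 0 < d) :
    Set.range (chart F i hF hd).left = ((hypersurfaceι F).left ⁻¹ᵁ Proj.basicOpen 𝒜 (X i) :
      Set (hypersurface F).left) := by
  rw [← Scheme.Hom.coe_opensRange, opensRange_chart_left]

/-- **`Spec A_i → X_F ↪ ℙⁿ⁺¹` is `Spec (k[x]_{(xᵢ)} → A_i)` followed by `D₊(xᵢ) ↪ ℙⁿ⁺¹`.**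
[folklore] -/
theorem chart_hypersurfaceι (hd : 0 < d) :
    chart F i hF hd ≫ hypersurfaceι F =
      specOverOfAlgHom (toChartRing F i hF) ≫ awayChartι (X_mem i) one_pos := by
  ext : 1
  change (Spec.map (CommRingCat.ofHom (chartRingEquiv F i hF hd).symm.toRingHom) ≫
      subschemePiece (idealSheaf F) (coordChartOpen k i)) ≫ (idealSheaf F).subschemeι =
    Spec.map (CommRingCat.ofHom (toChartRing F i hF).toRingHom) ≫ Proj.awayι 𝒜 (X i) (X_mem i) one_pos
  rw [Category.assoc, subschemePiece_ι, fromSpec_affineBasicOpen, ← Spec.map_comp_assoc,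
    ← Spec.map_comp_assoc, toChartRing_eq_symm_comp F i hF hd]
  rfl

/-! ### The universal property into reduced algebras -/

section Lift

variable {S : Type u} [CommRing S] [Algebra k S] [IsReduced S]

/-- The kernel of a ring map into a reduced ring is a radical ideal. [folklore] -/
theorem isRadical_ker_of_isReduced {A : Type*} [CommRing A] (f : A →+* S) :
    (RingHom.ker f).IsRadical :=
  fun a ⟨m, hm⟩ => by
    rw [RingHom.mem_ker] at hm ⊢
    rw [map_pow] at hm
    exact IsReduced.eq_zero _ ⟨m, hm⟩

/-- Evaluation at `v` with `F(v) = 0` kills `√(F/xᵢᵈ)` (reduced target). [folklore] -/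
theorem chartIdeal_le_ker (v : Fin (n + 2) → S)
    (hv : IsUnit (aeval v (X i : MvPolynomial (Fin (n + 2)) k))) (hFv : aeval v F = 0) :
    ∀ a ∈ chartIdeal F i hF, awayEvalU v hv a = 0 := by
  intro a ha
  have h : chartIdeal F i hF ≤ RingHom.ker (awayEvalU v hv).toRingHom := by
    refine ((isRadical_ker_of_isReduced _).radical_le_iff).mpr (Ideal.span_le.mpr ?_)
    rintro _ rfl
    rw [SetLike.mem_coe, RingHom.mem_ker, chartEqn, Away.isLocalizationElem]
    change awayEvalU v hv (Away.mk 𝒜 (X_mem i) d (F ^ 1) _) = 0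
    rw [awayEvalU_mk _ _ (X_mem i), pow_one, hFv, zero_mul]
  exact h ha

/-- **The universal property of the chart ring into reduced algebras**: a vector `v ∈ Sⁿ⁺²` with `vᵢ`
a unit and `F(v) = 0` (over a reduced `k`-algebra `S`) defines `A_i →ₐ[k] S`, `g/xᵢᵐ ↦ g(v) vᵢ⁻ᵐ`
(Mathlib `Ideal.Quotient.liftₐ` of `awayEvalU v`). [folklore] -/
def liftVec (v : Fin (n + 2) → S) (hv : IsUnit (aeval v (X i : MvPolynomial (Fin (n + 2)) k)))
    (hFv : aeval v F = 0) : ChartRing F i hF →ₐ[k] S :=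
  Ideal.Quotient.liftₐ (chartIdeal F i hF) (awayEvalU v hv) (chartIdeal_le_ker F i hF v hv hFv)

/-- `liftVec ∘ toChartRing = awayEvalU v`. [folklore] -/
theorem liftVec_toChartRing (v : Fin (n + 2) → S)
    (hv : IsUnit (aeval v (X i : MvPolynomial (Fin (n + 2)) k))) (hFv : aeval v F = 0)
    (q : Away 𝒜 (X i)) : liftVec F i hF v hv hFv (toChartRing F i hF q) = awayEvalU v hv q :=
  rfl

/-- `liftVec ∘ toChartRing = awayEvalU v` as algebra maps. [folklore] -/
theorem liftVec_comp_toChartRing (v : Fin (n + 2) → S)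
    (hv : IsUnit (aeval v (X i : MvPolynomial (Fin (n + 2)) k))) (hFv : aeval v F = 0) :
    (liftVec F i hF v hv hFv).comp (toChartRing F i hF) = awayEvalU v hv :=
  AlgHom.ext fun _ => rfl

/-- `liftVec` on the tautological vector: `xⱼ/xᵢ ↦ vⱼ · vᵢ⁻¹`. [folklore] -/
theorem liftVec_tautVec (v : Fin (n + 2) → S)
    (hv : IsUnit (aeval v (X i : MvPolynomial (Fin (n + 2)) k))) (hFv : aeval v F = 0)
    (j : Fin (n + 2)) : liftVec F i hF v hv hFv (tautVec F i hF j) = v j * ↑(hv.unit⁻¹) := by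
  rw [tautVec_apply, liftVec_toChartRing, coord, awayEvalU_mk _ _ (X_mem i), aeval_X, pow_one]

/-- **The `S`-point of `X_F` defined by `v` is, in `ℙⁿ⁺¹`, the point with homogeneous coordinates
`v`**: `Spec (liftVec v) ≫ chart ≫ (X_F ↪ ℙⁿ⁺¹) = vecChartPoint v`. [folklore] -/
theorem specOverOfAlgHom_liftVec_chart_hypersurfaceι (hd : 0 < d) (v : Fin (n + 2) → S)
    (hv : IsUnit (aeval v (X i : MvPolynomial (Fin (n + 2)) k))) (hFv : aeval v F = 0) :
    specOverOfAlgHom (liftVec F i hF v hv hFv) ≫ chart F i hF hd ≫ hypersurfaceι F =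
      vecChartPoint (X_mem i) one_pos v hv := by
  rw [chart_hypersurfaceι, ← Category.assoc, ← specOverOfAlgHom_comp, liftVec_comp_toChartRing]
  rfl

end Lift

end Literature.AlgebraicGeometry.Motives.SmoothHypersurface
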